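import Summits.BirchSwinnertonDyer.Rank1Residual.ManinAdditive.CuspidalKummerCubeDescentAtN
import Literature.NumberTheory.EllipticCurves.WeierstrassSigma
import HarnessLib
import HarnessLib.Audit.Tags

/-!
# The `σ`-monodromy line for P79 / G0: a cube root of the tangent-line Kummer class sees `E[3]`

Statement file (defs + `Prop`s, nothing asserted; cell `bsd-f2-manin`, planner `-an` g37, MEMO-an §80; proposed tree
path `Summits/BirchSwinnertonDyer/Rank1Residual/ManinAdditive/KummerCubeMonodromy.lean`).  Bears on crux C3
`ManinPrimeToThreeAtNine` (stmt-22968) of route `ManinLocalTwoThree` through the registered skeleton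
`Cruxes/ManinPrimeToThreeAtNine/Lines/kato_shift_three.lean`, whose geometric leaf is
P79 `CuspidalKummerThree.KummerCubeSeriesNotCubeAtThreeN` («`Θ_T` is not a cube in `K_{3N}`»), and on its level-`N`
half G0 `KummerCubeSeriesNotCubeAtN`.

THE LINE (no Kummer theory of `K_{3N}/K_N`, no cusp `0`, no Atkin–Lehner; optimality enters only through the lattice
clause `Λ_E = c·Λ_f`).  Write `u(τ) = 2πi∫_{i∞}^τ f`, `w = c·u`, `Λ = Λ_E = D.L.lattice`,
`P_s(w) = (c²℘_Λ(w), c³℘'_Λ(w)/2)` (the point of the short model `E_s : y² = x³ − c⁴c₄/48·x − c⁶c₆/864`),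
`t_s = −x_s/y_s`, and let `T = (X₀, Y₀) = P_s(a)` be a rational point of order `3` (`3a ∈ Λ`, `a ∉ Λ`).

* S1 `KummerCubeAnalyticDictionary` — the formal series `Θ_T(q)` (`kummerCubeSeries` at the parametrisation germ,
  `IsParamGerm`) is the `q`-expansion, for `Im τ ≫ 0`, of the meromorphic function
  `Θ^an(τ) = t_s(w)³ · (y_s(w) − Y₀ − α(x_s(w) − X₀))` («formal germ = parametrisation»; the tree's
  `IsXPresentation.exists_formalLog_subst_eq_and_formalXMulSq` is the `x`-half of exactly this dictionary).
* S2 `QExpansionCubeIdentityPrinciple` — `q`-expansion principle for a cube relation: if `F̂³ = Θ·Ĝ³` in `ℂ⟦q⟧` for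
  modular forms `F, G` and `Θ` sums to `θ(τ)` for `Im τ > B`, then `F(τ)³ = θ(τ)G(τ)³` there.
* S3 `SigmaTangentLineIdentity` — on `E_Λ : y² = x³ − (g₂/4)x − g₃/4` the tangent line at the flex `π(a)`, `3a ∈ Λ ∌ a`,
  pulled back to `ℂ` is `C · W_a(w)³`, `C ≠ 0`, with the `σ`-CUBE ROOT `W_a(w) = e^{η(3a)w/3} σ(w − a)/σ(w)`
  (`η(m₁ω₁ + m₂ω₂) = m₁η₁ + m₂η₂`): both sides are elliptic (Legendre) with divisor `3(a) − 3(0)`.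
* S3b `SigmaCubeRootNotPeriodic` — for `a ∉ Λ`, `W_a` is NOT `Λ`-periodic: `W_a(w + ω) = χ_a(ω)W_a(w)` with the
  Weil-pairing character `χ_a(n₁ω₁ + n₂ω₂) = exp(±2πi(m₁n₂ − m₂n₁)/3) ≢ 1`.
* S4 `SigmaCubeRootMonodromy` — analytic continuation / monodromy on `ℍ`: if modular forms `F, G` on `Γ₀(M)`, `N ∣ M`,
  satisfy `F³ = C·(t_s(w)·W(w))³·G³` near `i∞` (`W = W_{a,η}` any `σ`-cube-root), then `W` is periodic under every
  `c·{∞, γ∞}_f`, `γ ∈ Γ₀(N) ∩ Γ₀(M)` (`F/G` is `Γ₀(M)`-invariant, `t_s∘w` is, so `W∘w` is; identity theorem).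
* S5 = `Literature…ModularForms.closure_cuspSymbol_image_level_mul_eq_periodLattice` (PROVED, cell file
  `PeriodLatticeLevelRaising-an-g37.lean`): those periods generate `Λ_f` when `M = mN`, `m ∣ N`.
* S6 `ShortThreeTorsionLift` — a rational `3`-torsion point of the short model is `P_s(a)` with `3a ∈ Λ`, `a ∉ Λ`
  (uniformisation + the `σ`-division formula `σ(3a) = ψ₃(℘a, ℘'a/2)σ(a)⁹`, tree `PeriodPair.weierstrassSigma_nat_mul`).

* S3′ `TangentLineScaling` — the routine scaling identity `Θ^an_T = c³·t_s³·ℓ_a(w)` for `T = P_s(a)` (`α = c·α_a`).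

ASSEMBLY (MEMO-an §80.3; KERNEL-CHECKED in the cell files `HOME/an/g37/KummerSigmaMonodromyAssembly-an-g37.lean` —
`kummerCubeSeriesNotCubeAtThreeN_of_monodromy : S1 → S2 → S3 → S3b → S4 → S6 → S3′ → P79` and
`kummerCubeSeriesNotCubeAtN_of_monodromy : S1 → … → S3′ → G0`, self-contained farm check `KummerSigmaMonodromySim-an-g37.lean`
(rc 0 · 0 sorry · axioms propext/Classical.choice/Quot.sound); proposed tree path
`Summits/BirchSwinnertonDyer/BirchSwinnertonDyer/Theorems/ManinLocalTwoThreeKummerCubeMonodromy.lean --supports stmt-…-22968`):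
`u ∈ K_M`, `u³ = Θ̂_T`, `u·Ĝ = F̂` ⟹
`F̂³ = Θ̂Ĝ³` ⟹ (S1, S2) `F³ = Θ^an G³` near `i∞` ⟹ (S6, S3, scaling `α = c·α_a`) `F³ = C·(c·t_s·W_a(w))³G³` ⟹ (S4)
`W_a` periodic under `c·{∞,γ∞}_f`, `γ ∈ Γ₀(N) ∩ Γ₀(M)` ⟹ (S5 with `M = 3N`, `3 ∣ N`, or `M = N`; lattice clause
`Λ ⊆ c·Λ_f`; stabiliser of `W_a` is a subgroup) `W_a` is `Λ`-periodic ⟹ (S3b) `a ∈ Λ` — contradiction.  Hence P79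
(`M = 3N`, uses `9 ∣ N` only through `3 ∣ N`) and G0 (`M = N`).  The same proof with squares and
`W_a = e^{η(2a)w/2}σ(w−a)/σ(w)` gives the `ℓ = 2` Kummer statements at levels `2^k N`, `2 ∣ N`.

PARTITION unchanged · beyond-print theorem: no (classical: Weil pairing via `σ`, Manin 1972 Thm. 1.9; the typed
decomposition and S5 are the cell's) · BSD is not proved by this.

References: [Manin1972] Ju. I. Manin, *Parabolic points and zeta functions of modular curves* (1972), Thm. 1.9;
[SilvermanAEC2009] J. H. Silverman, AEC 2nd ed., VI.3 (σ, Legendre), Ex. 6.15 (σ-division formula), III.8 (Weil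
pairing); [WhittakerWatson1927] §20.41–20.53; [LangEllipticFunctions1987] S. Lang, *Elliptic Functions*, 2nd ed., Ch. 18
§1 (σ and the construction of elliptic functions with given divisor), [Stevens1989] G. Stevens, *Stickelberger elements
and modular parametrizations*, Invent. Math. 98 (1989), Thm. 2.3 (shape only).
-/

noncomputable section

open PowerSeries CongruenceSubgroup Complex
open scoped MatrixGroups ModularForm PeriodPair UpperHalfPlane
open WeierstrassCurve Literature.NumberTheory.EllipticCurves Literature.NumberTheory.EllipticCurves.ModularForms
open Summit.BirchSwinnertonDyer.Rank1Residual.ManinAdditive.CuspidalKummer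
open Summit.BirchSwinnertonDyer.Rank1Residual.ManinAdditive.CuspidalKummerThree

namespace Summit.BirchSwinnertonDyer.Rank1Residual.ManinAdditive.KummerCubeMonodromy

section Defs

variable {W : WeierstrassCurve ℚ} [W.IsElliptic] {N : ℕ} [NeZero N]

/-- `x_s(τ) = c²·℘_Λ(c·2πi∫_{i∞}^τ f)`: the `x`-coordinate of the short model `E_{W,c}` along the parametrisation
(`x_s = c²(x_W + b₂/12)`, `x_W = ℘_Λ − b₂/12` by `uniformize_spec`). [folklore] -/
def shortX (D : ModularParametrizationData W N) (τ : ℍ) : ℂ :=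
  (D.c : ℂ) ^ 2 * ℘[D.L] ((D.c : ℂ) * eichlerIntegral D.f τ)

/-- `y_s(τ) = c³·℘'_Λ(c·2πi∫_{i∞}^τ f)/2`: the `y`-coordinate of the short model along the parametrisation. [folklore] -/
def shortY (D : ModularParametrizationData W N) (τ : ℍ) : ℂ :=
  (D.c : ℂ) ^ 3 * ℘'[D.L] ((D.c : ℂ) * eichlerIntegral D.f τ) / 2

/-- `t_s = −x_s/y_s`, the local parameter at `O` of the short model along the parametrisation (junk `0` at the
images of `E[2]`). [folklore] -/
def shortT (D : ModularParametrizationData W N) (τ : ℍ) : ℂ :=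
  -shortX D τ / shortY D τ

/-- **`Θ^an_T(τ) = t_s³·(y_s − Y₀ − α·(x_s − X₀))`**, the tangent-line Kummer FUNCTION of `T = (X₀, Y₀)` on `ℍ`
(`α = tangentSlope`), whose `q`-expansion at `i∞` is the formal `kummerCubeSeries` (S1). [folklore] -/
def kummerCubeFunction (D : ModularParametrizationData W N) (X₀ Y₀ : ℚ) (τ : ℍ) : ℂ :=
  shortT D τ ^ 3 *
    (shortY D τ - (Y₀ : ℂ) - ((tangentSlope W D.c X₀ Y₀ : ℚ) : ℂ) * (shortX D τ - (X₀ : ℂ)))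

end Defs

/-- **The `σ`-cube root** `W_{a,e}(w) = exp(e·w/3) · σ_Λ(w − a)/σ_Λ(w)` (junk `0` on `Λ`; the variable `e` is the quasi-period `η(3a)`,
named `e` because `η` is Mathlib notation for Dedekind's eta).  For `3a = m₁ω₁ + m₂ω₂ ∈ Λ` and `e = m₁η₁ + m₂η₂` its cube is elliptic with divisor `3(a) − 3(0)` (Legendre), and
`W(w + ω) = χ_a(ω)·W(w)` with `χ_a` the Weil pairing `e₃(π(a), π(ω/3))`.
[cite: SilvermanAEC2009, VI.3 (σ-function; construction of elliptic functions with prescribed divisor)] -/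
def sigmaCubeRoot (L : PeriodPair) (a e w : ℂ) : ℂ :=
  cexp (e * w / 3) * L.weierstrassSigma (w - a) / L.weierstrassSigma w

/-- The tangent-line function of `E_Λ : y² = x³ − (g₂/4)x − g₃/4` at the point `π(a) = (℘a, ℘'a/2)`, pulled back to
`ℂ`: `ℓ_a(w) = ℘'(w)/2 − ℘'(a)/2 − α_a·(℘(w) − ℘(a))`, `α_a = (3℘(a)² − g₂/4)/℘'(a)`. [folklore] -/
def tangentLinePullback (L : PeriodPair) (a w : ℂ) : ℂ :=
  ℘'[L] w / 2 - ℘'[L] a / 2 - (3 * ℘[L] a ^ 2 - L.g₂ / 4) / ℘'[L] a * (℘[L] w - ℘[L] a)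

/-! ### S1 — the analytic dictionary at `i∞` -/

/-- **S1 `KummerCubeAnalyticDictionary` (support, theorem-grade).**  For a parametrisation datum `D` and THE formal
germ `z` (`IsParamGerm W c a z`: `log_{E_s}(z) = Σ aₙqⁿ/n`), the formal tangent-line Kummer series `Θ_T(q)` of ANY
pair `(X₀, Y₀)` converges for `Im τ > B` to `Θ^an_T(τ)` (`kummerCubeFunction`).  Proof sketch: `z(q) = t_s(w(τ))`
because `log_{E_s}(t_s∘P_s(w)) = w/c = Σaₙqⁿ/n` (invariant differential of `E_s` is `dw/c`; `hasSum_eichlerIntegral`)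
and `log` is injective on germs; `x_s = z⁻²X_E(z)`, `y_s = −z⁻³X_E(z)·…` converge (tree: `FormalExpTaylorUniformization`,
`IsXPresentation.exists_formalLog_subst_eq_and_formalXMulSq` = the `x`-half).  `c ≠ 0` is needed (for `c = 0` the
short model is `y² = x³`, `z = Σaₙqⁿ/n`, `Θ = −1 − …` while `Θ^an ≡ 0`).  Why it might fail: only by a
normalisation slip (`c²`, `c³/2`, sign of `t`), which the falsifier §80.4 checks on `27a1`.
[cite: CremonaAlgorithms1997, §2.10 (q-expansion of the parametrisation; shape)] -/
@[conjecture]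
def KummerCubeAnalyticDictionary : Prop :=
  ∀ (W : WeierstrassCurve ℚ) [W.IsElliptic] [W.IsGloballyMinimal] {N : ℕ} [NeZero N]
    (D : ModularParametrizationData W N) (a : ℕ → ℤ), (∀ n, (a n : ℂ) = cuspCoeff D.f n) → D.c ≠ 0 →
    ∀ (X₀ Y₀ : ℚ) (z : ℚ⟦X⟧), IsParamGerm W D.c a z →
    ∃ B : ℝ, ∀ τ : ℍ, B < τ.im →
      HasSum (fun n : ℕ ↦ ((coeff n (kummerCubeSeries W D.c X₀ Y₀ z) : ℚ) : ℂ) *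
          Function.Periodic.qParam 1 (τ : ℂ) ^ n)
        (kummerCubeFunction D X₀ Y₀ τ)

/-! ### S2 — `q`-expansion principle for a cube relation -/

/-- **S2 `QExpansionCubeIdentityPrinciple` (support, theorem-grade; pure `q`-expansion analysis).**  If the
`q`-expansions of `F, G ∈ M_k(Γ₀(M))` satisfy `F̂³ = Θ·Ĝ³` in `ℂ⟦q⟧` and `Θ` sums to `θ(τ)` for `Im τ > B`, then
`F(τ)³ = θ(τ)·G(τ)³` for `Im τ > B` (`hasSum_qExpansion`, multiplicativity of `qExpansion`, products of absolutely
convergent `q`-series).  Why it might fail: it cannot beyond typing (`qExpansion 1` is the expansion in `e^{2πiτ}` for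
`Γ₀(M)`, width `1` at `∞`). [cite: DiamondShurman2005, §1.1–1.2 (q-expansions; shape)] -/
@[conjecture]
def QExpansionCubeIdentityPrinciple : Prop :=
  ∀ (M : ℕ) [NeZero M] (k : ℤ) (F G : ModularForm (Gamma0 M) k) (Θ : PowerSeries ℂ) (θ : ℍ → ℂ) (B : ℝ),
    (∀ τ : ℍ, B < τ.im → HasSum (fun n : ℕ ↦ coeff n Θ * Function.Periodic.qParam 1 (τ : ℂ) ^ n) (θ τ)) →
    UpperHalfPlane.qExpansion 1 F ^ 3 = Θ * UpperHalfPlane.qExpansion 1 G ^ 3 →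
    ∀ τ : ℍ, B < τ.im → F τ ^ 3 = θ τ * G τ ^ 3

/-! ### S3, S3b — the `σ`-cube root of the flex tangent line -/

/-- **S3 `SigmaTangentLineIdentity` (support, theorem-grade; Weierstrass `σ`-theory).**  For `a ∉ Λ` with
`3a = m₁ω₁ + m₂ω₂ ∈ Λ` there is `C ≠ 0` with `ℓ_a(w) = C · W_{a, m₁η₁+m₂η₂}(w)³` for all `w ∉ Λ`: `W³` is
`Λ`-periodic (`σ(z + ωᵢ) = −e^{ηᵢ(z + ωᵢ/2)}σ(z)` + Legendre `η₁ω₂ − η₂ω₁ = ±2πi`), both sides are elliptic with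
divisor `3(a) − 3(0)` (`π(a)` is a flex: `ℓ_a∘π` vanishes to order `3` at `a` — value, `℘'' = 6℘² − g₂/2`,
`℘''' = 12℘℘'` and `ψ₃(℘a) = 0`), so the ratio is a pole-free elliptic function, i.e. constant (Liouville).  Why it
might fail: a sign/normalisation of `η(3a)` (then `W³` is not periodic) — fixed by the tree's `weierstrassSigma_add_ωᵢ`.
[cite: SilvermanAEC2009, VI.3 (Prop. 3.4-type construction via σ); WhittakerWatson1927, §20.53] -/
@[conjecture]
def SigmaTangentLineIdentity : Prop :=
  ∀ (L : PeriodPair) (a : ℂ) (m₁ m₂ : ℤ), a ∉ L.lattice → 3 * a = m₁ * L.ω₁ + m₂ * L.ω₂ →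
    ∃ C : ℂ, C ≠ 0 ∧ ∀ w : ℂ, w ∉ L.lattice →
      tangentLinePullback L a w = C * sigmaCubeRoot L a (m₁ * L.η₁ + m₂ * L.η₂) w ^ 3

/-- **S3b `SigmaCubeRootNotPeriodic` (support, theorem-grade).**  For `a ∉ Λ`, `3a = m₁ω₁ + m₂ω₂`, the cube root
`W_{a,η(3a)}` is not `Λ`-periodic: `W(w + ω₁) = exp(∓2πi m₂/3)W(w)`, `W(w + ω₂) = exp(±2πi m₁/3)W(w)` (quasi-periodicity
of `σ` + Legendre) and `3 ∤ m₁` or `3 ∤ m₂` since `a ∉ Λ`; `W ≢ 0`.  (The multiplier is the Weil pairing `e₃(π a, ·)`.)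
Why it might fail: it cannot (classical); typed so that junk values (`σ(w) = 0 ⇒ W = 0`) do not matter (`∃ w`).
[cite: SilvermanAEC2009, VI.3 and III.8 (Weil pairing via σ; shape)] -/
@[conjecture]
def SigmaCubeRootNotPeriodic : Prop :=
  ∀ (L : PeriodPair) (a : ℂ) (m₁ m₂ : ℤ), a ∉ L.lattice → 3 * a = m₁ * L.ω₁ + m₂ * L.ω₂ →
    ∃ ω ∈ L.lattice, ∃ w : ℂ,
      sigmaCubeRoot L a (m₁ * L.η₁ + m₂ * L.η₂) (w + ω) ≠ sigmaCubeRoot L a (m₁ * L.η₁ + m₂ * L.η₂) w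

/-! ### S4 — monodromy on `ℍ` -/

/-- **S4 `SigmaCubeRootMonodromy` (crux of the line, theorem-grade; complex analysis on `ℍ`).**  Let `N ∣ M`,
`F, G ∈ M_k(Γ₀(M))`, `G ≠ 0`, `C ≠ 0`, and suppose `F(τ)³ = C·(t_s(τ)·W(w(τ)))³·G(τ)³` whenever `Im τ > B` and
`w(τ) = c·u(τ) ∉ Λ`, for a `σ`-cube-root `W = W_{a,η}` of the Néron lattice `Λ = D.L`.  Then `W` is periodic under
`c·{∞, γ∞}_f` for every `γ ∈ Γ₀(N)` lying in `Γ₀(M)`.  Proof sketch: `F ≢ 0`; `F = κ·t_s·(W∘w)·G` near `i∞`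
(continuous cube root of unity on a connected set), hence on `ℍ` as meromorphic functions (identity theorem;
`W` is meromorphic on `ℂ`, `t_s∘w`, `F`, `G` on `ℍ`); `F/G` and `t_s∘w` are `Γ₀(M)`-invariant
(`w(γτ) = w(τ) + c{∞,γ∞}_f`, `eichlerIntegral_smul_sub_holds`, `c{∞,γ∞}_f ∈ Λ` by `smul_periodLattice_le`), so
`W(w(τ) + c{∞,γ∞}) = W(w(τ))` on a co-discrete subset of `ℍ`; `w` is a non-constant holomorphic map, hence open, and
`W(· + λ) − W` is analytic on the connected set `ℂ ∖ Λ`, so it vanishes there; on `Λ` both sides are the junk `0`.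
Why it might fail: only through junk-value conventions at poles (checked: `σ(w) = 0 ⇔ w ∈ Λ`, `λ ∈ Λ`), or if
`t_s∘w ≡ 0` (impossible: `t_s ∼ −c⁻¹·2℘/℘' ∼ q` at `i∞`). [cite: Manin1972, Prop. 1.4 (u(γτ) − u(τ) = {∞,γ∞}; shape)] -/
@[conjecture]
def SigmaCubeRootMonodromy : Prop :=
  ∀ (W : WeierstrassCurve ℚ) [W.IsElliptic] [W.IsGloballyMinimal] {N : ℕ} [NeZero N]
    (D : ModularParametrizationData W N) (a e : ℂ) (M : ℕ) [NeZero M] (k : ℤ)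
    (F G : ModularForm (Gamma0 M) k) (C : ℂ) (B : ℝ), N ∣ M → G ≠ 0 → C ≠ 0 →
    (∀ τ : ℍ, B < τ.im → (D.c : ℂ) * eichlerIntegral D.f τ ∉ D.L.lattice →
      F τ ^ 3 = C * (shortT D τ * sigmaCubeRoot D.L a e ((D.c : ℂ) * eichlerIntegral D.f τ)) ^ 3 * G τ ^ 3) →
    ∀ γ : Gamma0 N, (γ : SL(2, ℤ)) ∈ Gamma0 M →
      ∀ w₀ : ℂ, sigmaCubeRoot D.L a e (w₀ + (D.c : ℂ) * cuspSymbol D.f γ) = sigmaCubeRoot D.L a e w₀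

/-! ### S6 — rational `3`-torsion of the short model lifts to `(1/3)Λ ∖ Λ` -/

/-- **S6 `ShortThreeTorsionLift` (support, theorem-grade).**  A rational point `(X₀, Y₀)` of order `3` on the short
model `E_{W,c}` (`IsShortThreeTorsion`: nonsingular, `Ψ₃(X₀) = 0`) is `P_s(a) = (c²℘(a), c³℘'(a)/2)` for some `a ∉ Λ`
with `3a ∈ Λ` (and `℘'(a) ≠ 0`, i.e. `2a ∉ Λ`: tree `two_mul_mem_lattice_of_derivWeierstrassP_eq_zero`; `c ≠ 0` since
`y² = x³` has no nonsingular `Ψ₃`-root point): existence of `a` from `uniformize_surjective` + `uniformize_spec` + the change of variables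
`(x,y) ↦ (c²(x + b₂/12), c³(y + (a₁x + a₃)/2))` (`isNeronLattice`: `g₂ = c₄/12`, `g₃ = c₆/216`); then
`Ψ₃^{E_s}(c²x) = c⁸ψ₃^{E_Λ}(x)` and the `σ`-division formula `σ(3a) = ψ₃(℘a, ℘'a/2)·σ(a)⁹`
(`PeriodPair.weierstrassSigma_nat_mul`) give `σ(3a) = 0`, i.e. `3a ∈ Λ` (`weierstrassSigma_eq_zero_iff`); `c = 0` is
excluded by nonsingularity.  Why it might fail: it cannot beyond the variable-change bookkeeping.
[cite: SilvermanAEC2009, Exercise 6.15 and VI.5.1 (uniformisation)] -/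
@[conjecture]
def ShortThreeTorsionLift : Prop :=
  ∀ (W : WeierstrassCurve ℚ) [W.IsElliptic] [W.IsGloballyMinimal] {N : ℕ} [NeZero N]
    (D : ModularParametrizationData W N) (X₀ Y₀ : ℚ), IsShortThreeTorsion W D.c X₀ Y₀ →
    D.c ≠ 0 ∧ ∃ a : ℂ, a ∉ D.L.lattice ∧ 3 * a ∈ D.L.lattice ∧ ℘'[D.L] a ≠ 0 ∧
      (D.c : ℂ) ^ 2 * ℘[D.L] a = (X₀ : ℂ) ∧ (D.c : ℂ) ^ 3 * ℘'[D.L] a / 2 = (Y₀ : ℂ)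

/-! ### The scaling identity used between S3 and S4 (recorded as a statement; routine) -/

/-- **S3′ `TangentLineScaling` (support, routine algebra).**  With `X₀ = c²℘(a)`, `Y₀ = c³℘'(a)/2` (S6) and
`a₄(E_s) = −c⁴g₂/4` (`isNeronLattice`), the short-model tangent slope is `α = c·α_a` and
`y_s − Y₀ − α(x_s − X₀) = c³·ℓ_a(w)`; hence `Θ^an_T(τ) = c³·t_s(τ)³·ℓ_a(w(τ))`.  Why it might fail: it cannot
(ring identity given `g₂(Λ) = c₄(W)/12`). [folklore] -/
@[conjecture]
def TangentLineScaling : Prop :=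
  ∀ (W : WeierstrassCurve ℚ) [W.IsElliptic] [W.IsGloballyMinimal] {N : ℕ} [NeZero N]
    (D : ModularParametrizationData W N) (X₀ Y₀ : ℚ) (a : ℂ),
    (D.c : ℂ) ^ 2 * ℘[D.L] a = (X₀ : ℂ) → (D.c : ℂ) ^ 3 * ℘'[D.L] a / 2 = (Y₀ : ℂ) → ℘'[D.L] a ≠ 0 →
    ∀ τ : ℍ, kummerCubeFunction D X₀ Y₀ τ =
      (D.c : ℂ) ^ 3 * shortT D τ ^ 3 * tangentLinePullback D.L a ((D.c : ℂ) * eichlerIntegral D.f τ)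

end Summit.BirchSwinnertonDyer.Rank1Residual.ManinAdditive.KummerCubeMonodromy

end
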